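import Literature.MathematicalPhysics.QuantumLattice.HubbardSchwingerFunctionBound
import Literature.MathematicalPhysics.QuantumLattice.HubbardCommutatorBound
import HarnessLib

/-!
# Equicontinuity in the imaginary time of the Hubbard Schwinger function, uniformly in the volume

Topic `MathematicalPhysics/QuantumLattice`; programme under the tree's fact `bgm_two_point_limit`
(`HubbardFermiLiquid.lean`; Benfatto–Giuliani–Mastropietro, Ann. Henri Poincaré 7 (2006) 809,
§1.2 (1.2)–(1.3): the finite-temperature Schwinger functions `S^{β,L}`). Combining the Lipschitz
bound `|⟨A(b)B⟩_β - ⟨A(a)B⟩_β| ≤ ‖[H,A]‖ ‖B‖ (b - a)` (`0 ≤ a ≤ b ≤ β`) of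
`HubbardSchwingerFunctionBound.lean` with the volume-independent commutator bound
`‖[H(1,U) - μN, c^{(†)}_{x̄σ}]‖ ≤ 18 (2 + |U| + 2|μ|)` on the 2D torus of
`HubbardCommutatorBound.lean` gives: BGM's two-point Schwinger function of the Hubbard torus
`τ ↦ S^{β,L}((τ,x⃗),σ,-;(0,y⃗),σ',+)` is Lipschitz on `(0, β]` and on `[-β, 0)` with the constant
`18 (2 + |U| + 2|μ|)`, the SAME for every volume `L` (`norm_hubbardSchwingerTwoPoint_sub_le`,
`norm_hubbardSchwingerTwoPoint_sub_le_of_neg`). Together with `|S^{β,L}| ≤ 1`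
(`norm_hubbardSchwingerTwoPoint_le_one`) this is the Arzelà–Ascoli input for thermodynamic limits
of `S^{β,L}` along subsequences as continuous functions of the time difference; the jump at `τ = 0`
is the canonical anticommutator and is why the two half-intervals are treated separately.
Everything is PROVED; no definition. (Uniqueness of the limit — BGM's Theorem 1.1 — is not
claimed.)

## References

* G. Benfatto, A. Giuliani, V. Mastropietro, Ann. Henri Poincaré 7 (2006) 809–898, §1.2
  (1.2)–(1.3) and footnote 1. [BenfattoGiulianiMastropietro2006]
* O. Bratteli, D. W. Robinson, *Operator Algebras and Quantum Statistical Mechanics II*, 2nd ed.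
  (Springer 1997), §5.3.1 (KMS correlation functions on the strip). [BratteliRobinsonII1997]
-/

noncomputable section

open scoped Matrix.Norms.L2Operator ComplexOrder
open Matrix Finset NormedSpace


/-! ### Equicontinuity of the Hubbard Schwinger function in the imaginary time, uniformly in `L` -/

namespace Literature.MathematicalPhysics.QuantumLattice

section Equicontinuity

open Literature.Probability.LatticeModels

/-- **Equi-Lipschitz continuity of BGM's Schwinger function in the time difference, positive
times**: for `0 < a ≤ b ≤ β` and every volume `L`,
`|S^{β,L}((b,x⃗),σ,-;(0,y⃗),σ',+) - S^{β,L}((a,x⃗),σ,-;(0,y⃗),σ',+)| ≤ 18 (2 + |U| + 2|μ|) (b - a)`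
(`S(τ,0) = ⟨c_{x̄σ}(τ) c†_{ȳσ'}⟩`, derivative `⟨[H,c](τ)c†⟩` bounded by `‖[H,c]‖ ≤ 18(2+|U|+2|μ|)` via
the two-time Gibbs bound) — with `|S| ≤ 1` this is the Arzelà–Ascoli input for subsequential
limits `L → ∞` as continuous functions of the time. BGM 2006 §1.2. [folklore] -/
theorem norm_hubbardSchwingerTwoPoint_sub_le (β U μ : ℝ) (L : ℕ) {a b : ℝ} (ha : 0 < a) (hab : a ≤ b)
    (hb : b ≤ β) (x : Site 2) (σ : Fin 2) (y : Site 2) (σ' : Fin 2) :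
    ‖hubbardSchwingerTwoPoint β U μ L b x σ 0 y σ' - hubbardSchwingerTwoPoint β U μ L a x σ 0 y σ'‖ ≤
      18 * (2 + |U| + 2 * |μ|) * (b - a) := by
  by_cases hL : L = 0
  · have h0 : (0 : ℝ) ≤ 18 * (2 + |U| + 2 * |μ|) * (b - a) := by
      have : 0 ≤ b - a := sub_nonneg.mpr hab
      positivity
    simpa [hubbardSchwingerTwoPoint, hL] using h0
  · haveI : NeZero L := ⟨hL⟩
    haveI : Nonempty (Finset (Orb (FermionTorus 2 L))) := ⟨∅⟩
    have hH : (hamiltonianWith (fermionTorusGraph 2 L) 1 U μ).IsHermitian :=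
      isHermitian_hamiltonianWith _ 1 U μ
    have hc := norm_commutator_hubbardTorusWith_annihilation_le U μ L
      (FermionTorus.ofTorusSite (Torus.proj L x)) σ
    have hBn := norm_creation_le_one (ι := Orb (FermionTorus 2 L))
      (orb (FermionTorus.ofTorusSite (Torus.proj L y)) σ')
    rw [hubbardTorusWith] at hc
    set A : Matrix (Finset (Orb (FermionTorus 2 L))) (Finset (Orb (FermionTorus 2 L))) ℂ :=
      annihilation (orb (FermionTorus.ofTorusSite (Torus.proj L x)) σ) with hA
    set B : Matrix (Finset (Orb (FermionTorus 2 L))) (Finset (Orb (FermionTorus 2 L))) ℂ :=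
      creation (orb (FermionTorus.ofTorusSite (Torus.proj L y)) σ') with hB
    rw [hubbardSchwingerTwoPoint_eq, hubbardSchwingerTwoPoint_eq, ← hA, ← hB, hubbardTorusWith,
      Matrix.schwingerTwoPoint_of_lt _ _ _ _ (ha.trans_le hab), Matrix.schwingerTwoPoint_of_lt _ _ _ _ ha,
      Complex.ofReal_zero, Matrix.imagTimeEvolve_zero]
    refine (norm_gibbsState_imagTimeEvolve_mul_sub_le_of_isHermitian hH ha.le hab hb A B).trans ?_
    have hba : 0 ≤ b - a := sub_nonneg.mpr hab
    calc ‖hamiltonianWith (fermionTorusGraph 2 L) 1 U μ * A - A * hamiltonianWith (fermionTorusGraph 2 L) 1 U μ‖ * ‖B‖ * (b - a)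
        ≤ 18 * (2 + |U| + 2 * |μ|) * 1 * (b - a) :=
          mul_le_mul_of_nonneg_right (mul_le_mul hc hBn (norm_nonneg _) (by positivity)) hba
      _ = 18 * (2 + |U| + 2 * |μ|) * (b - a) := by rw [mul_one]

/-- **Equi-Lipschitz continuity, negative times**: for `-β ≤ a ≤ b < 0` and every `L`,
`|S^{β,L}((b,x⃗),σ,-;(0,y⃗),σ',+) - S^{β,L}((a,x⃗),σ,-;(0,y⃗),σ',+)| ≤ 18 (2 + |U| + 2|μ|) (b - a)`
(`S(τ,0) = -⟨c†_{ȳσ'} c_{x̄σ}(τ)⟩ = -⟨c†_{ȳσ'}(-τ) c_{x̄σ}⟩`, `-τ ∈ [0, β]`). BGM 2006 §1.2. [folklore] -/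
theorem norm_hubbardSchwingerTwoPoint_sub_le_of_neg (β U μ : ℝ) (L : ℕ) {a b : ℝ} (ha : -β ≤ a)
    (hab : a ≤ b) (hb : b < 0) (x : Site 2) (σ : Fin 2) (y : Site 2) (σ' : Fin 2) :
    ‖hubbardSchwingerTwoPoint β U μ L b x σ 0 y σ' - hubbardSchwingerTwoPoint β U μ L a x σ 0 y σ'‖ ≤
      18 * (2 + |U| + 2 * |μ|) * (b - a) := by
  by_cases hL : L = 0
  · have h0 : (0 : ℝ) ≤ 18 * (2 + |U| + 2 * |μ|) * (b - a) := by
      have : 0 ≤ b - a := sub_nonneg.mpr hab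
      positivity
    simpa [hubbardSchwingerTwoPoint, hL] using h0
  · haveI : NeZero L := ⟨hL⟩
    haveI : Nonempty (Finset (Orb (FermionTorus 2 L))) := ⟨∅⟩
    have hH : (hamiltonianWith (fermionTorusGraph 2 L) 1 U μ).IsHermitian :=
      isHermitian_hamiltonianWith _ 1 U μ
    have hc := norm_commutator_hubbardTorusWith_creation_le U μ L
      (FermionTorus.ofTorusSite (Torus.proj L y)) σ'
    have hAn := norm_annihilation_le_one (ι := Orb (FermionTorus 2 L))
      (orb (FermionTorus.ofTorusSite (Torus.proj L x)) σ)
    rw [hubbardTorusWith] at hc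
    set A : Matrix (Finset (Orb (FermionTorus 2 L))) (Finset (Orb (FermionTorus 2 L))) ℂ :=
      annihilation (orb (FermionTorus.ofTorusSite (Torus.proj L x)) σ) with hA
    set B : Matrix (Finset (Orb (FermionTorus 2 L))) (Finset (Orb (FermionTorus 2 L))) ℂ :=
      creation (orb (FermionTorus.ofTorusSite (Torus.proj L y)) σ') with hB
    rw [hubbardSchwingerTwoPoint_eq, hubbardSchwingerTwoPoint_eq, ← hA, ← hB, hubbardTorusWith,
      Matrix.schwingerTwoPoint_of_le _ _ _ _ hb.le, Matrix.schwingerTwoPoint_of_le _ _ _ _ (hab.trans hb.le),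
      Matrix.gibbsState_imagTimeEvolve_mul_imagTimeEvolve, Matrix.gibbsState_imagTimeEvolve_mul_imagTimeEvolve,
      Complex.ofReal_zero, zero_sub, zero_sub, ← Complex.ofReal_neg, ← Complex.ofReal_neg, ← neg_sub', norm_neg,
      norm_sub_rev]
    -- now `‖⟨B(-a) A⟩ - ⟨B(-b) A⟩‖` with `0 ≤ -b ≤ -a ≤ β`
    refine (norm_gibbsState_imagTimeEvolve_mul_sub_le_of_isHermitian hH (neg_nonneg.mpr hb.le)
      (neg_le_neg hab) (neg_le.mp ha) B A).trans ?_
    have hba : 0 ≤ -a - -b := by linarith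
    calc ‖hamiltonianWith (fermionTorusGraph 2 L) 1 U μ * B - B * hamiltonianWith (fermionTorusGraph 2 L) 1 U μ‖ * ‖A‖ * (-a - -b)
        ≤ 18 * (2 + |U| + 2 * |μ|) * 1 * (-a - -b) :=
          mul_le_mul_of_nonneg_right (mul_le_mul hc hAn (norm_nonneg _) (by positivity)) hba
      _ = 18 * (2 + |U| + 2 * |μ|) * (b - a) := by ring

end Equicontinuity

end Literature.MathematicalPhysics.QuantumLattice
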